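import Summits.KontsevichZagierPeriods.KontsevichZagierPeriods.Theses.FurushoPentagon
import Summits.KontsevichZagierPeriods.KontsevichZagierPeriods.Theses.LiftingCriteria
import Summits.KontsevichZagierPeriods.KontsevichZagierPeriods.Theorems.FurushoPentagonSectorToKernelResolvedRing
import Summits.KontsevichZagierPeriods.KontsevichZagierPeriods.Theorems.HurwitzMicroSectorsNormalFormPrinciplePiBoxTower
import Summits.KontsevichZagierPeriods.KontsevichZagierPeriods.Theorems.ReducedPeriodRing.Negative.KernelControlModPi
import Summits.KontsevichZagierPeriods.KontsevichZagierPeriods.Theorems.FurushoPentagonReducedPeriodRingLinStokesSymDefs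
import Summits.KontsevichZagierPeriods.KontsevichZagierPeriods.Theorems.FurushoPentagonReducedPeriodRingSubdivGeneration
import Summits.KontsevichZagierPeriods.KontsevichZagierPeriods.Theorems.FurushoPentagonReducedPeriodRingReflectionGeneration
import Summits.KontsevichZagierPeriods.KontsevichZagierPeriods.Theorems.FurushoPentagonLinStokesSymCovReduction
import Summits.KontsevichZagierPeriods.KontsevichZagierPeriods.Theorems.FurushoPentagonReducedPeriodRingHyperoctahedralFactorisation
import Summits.KontsevichZagierPeriods.KontsevichZagierPeriods.Theorems.FurushoPentagonReducedPeriodRingCovGeneration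
import Literature.NumberTheory.Transcendental.KZCubicalCalculus
import Literature.NumberTheory.Transcendental.KZProduct
import Literature.NumberTheory.Transcendental.KZProductIdeal
import Literature.NumberTheory.Transcendental.KZRulesAssociator

/-!
# `ReducedPeriodRing` (stmt-KontsevichZagierPeriods-3929), line `lin-stokes-sym`: proof skeleton v4 (lead c9)

Crux (route FurushoPentagon, rank 3): `∀ c : KZ.FormalRep, c * c ∈ KZ.relations → c ∈ KZ.relations`
(the formal period ring `P = FormalRep ⧸ relations` of the Kontsevich–Zagier calculus is reduced).
Crux-strategist line (unit `cstrat-stmt-KontsevichZagierPeriods-3929-s1`, gen 1), the REPAIR of the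
dead line `ayoub-stokes-cartier` at exactly the step that died.

## What died and how this differs

`ayoub-stokes-cartier` pinned the target of the `[π]`-localisation transfer to
`ayoubIdeal := closure (KZ.cubicalLinGens ∪ KZ.cubicalStokesGens)` — Newton–Leibniz along the LAST
coordinate only — and its kernel-control stub S2 was refuted by lead c2
(`Theorems/ReducedPeriodRing/Negative/KernelControlModPi.lean`, `not_kernelControlModPi`): the SLICE
functionals `Sl N` (Dirac mass at `0` below level `N`, Lebesgue on `[0,½]` at `N`, Lebesgue above) are
algebraic-valued on that ideal but equal `π/2` on every `[κ]^N ⋆ a₀`, `a₀ = [g] − [½g(·/2)] − [½g((1+·)/2)]`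
ONE dyadic-subdivision generator. Diagnosis (lead c2, `Lines/ayoub-stokes-cartier-dead.md`): the ideal
missed the COORDINATE SYMMETRIES, so "partial primitives in one coordinate at a slice" survived; Ayoub's
relation module has `∂f/∂zᵢ − f|_{zᵢ=1} + f|_{zᵢ=0}` for EVERY `i`.

This line pins the target to `linStokesSymIdeal := closure (Lin ∪ StokesLast ∪ Sym)` with
`Sym = {[r] − [r.reindex σ]}` (coordinate permutations of tame cubes; Stokes in every coordinate is
StokesLast conjugated by Sym), and its NEW load-bearing stubs S2a′ `stub_subdivGeneration` / S2a″ `stub_covGeneration` say that this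
three-family ideal already contains the tree's FOUR-family cubical move span `KZ.cubicalSpan` (dyadic
subdivision, resp. change of variables along self-maps of the cube; assembled as `greenGeneration`).
Both are PROVABLE NOW by the "closed-form / Green" mechanism (line card §Stubs; the refuting witness
worked in full in the docstring of S2a′):
`a₀ ≡ −[∂ₛΨ]` by StokesLast with `Ψ(x,s) = Φ(x,s/2)`, `Φ(x,t) = t g(tx) + (1−t) g(t+(1−t)x) − g(x)`, and
`∂ₛΨ = ∂ₓV`, `V(x,s) = ½(x g(sx/2) − (x−1) g(s/2 + (1−s/2)x))`, so after ONE coordinate swap (Sym)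
StokesLast gives `[∂ₓV] ≡ [V(1,·) − V(0,·)] = [0]`: the refuting witness lies in `linStokesSymIdeal`
with NO `κ`-power. The same two-coordinate Stokes identity `∂_y(f(φ)φ_x) = ∂_x(f(φ)φ_y)` with
`φ(x,y) = x(1−y)` gives reflection invariance `[f] ≡ [f(1−·)]`, with `φ(x,y) = x·Φ(1−y)` every
one-dimensional cubical change of variables, and with the pull-back of `f du₁∧…∧duₙ` along the
straight-line homotopy `(1−y)x + yΦ(x)` every face-preserving cubical change of variables in dimension
`n` (side faces degenerate); general ones are face-preserving after a hyperoctahedral symmetry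
(Sym + reflections). So the slice-functional certificate — and every certificate that needs an ORDER on
the coordinates (dead note, item 4) — is dead against this ideal, constructively.

## Status (lead c9, 2026-08-17T12:00Z) — skeleton v2

LANDED: the vocabulary (`Theorems/FurushoPentagonReducedPeriodRingLinStokesSymDefs.lean`, p151498),
S2a′ `stub_subdivGeneration` (`…SubdivGeneration.lean`, p153513), the reshape of S2a″ into
`stub_reflectionGeneration` (`…ReflectionGeneration.lean`, p154244) + the signed-Jacobian /
homotopy / closedness / face / reduction chain (`Theorems/FurushoPentagonLinStokesSymCov{Det,Homotopy,
Closed,Face,Reduction}.lean`, p155408 p155897 p156635 p157523 p158130) which proves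
`stub_covGeneration_reduction : (hyperoctahedral facet structure of analytic cube automorphisms) →
KZ.cubicalCovGens ⊆ linStokesSymIdeal`, and the facet structure itself
`stub_hyperoctahedralFactorisation` (`Theorems/FurushoPentagonLinStokesSymHyperoctahedral{Boundary,Facet}.lean`
p160227 p160615 + `…ReducedPeriodRingHyperoctahedralFactorisation.lean` p160962: invariance of
domain for `Φ` and `Φ⁻¹`, finite Baire + identity theorem on facets, combinatorics of the facet
map). So S2a′ and S2a″ are CLOSED and LANDED: `stub_covGeneration` and `greenGeneration : KZ.cubicalSpan ≤
linStokesSymIdeal` (`Theorems/FurushoPentagonReducedPeriodRingCovGeneration.lean`, p162092) are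
imported and used by name below.
OPEN: S1 (= item 3574, live line on route LiftingCriteria), S2b `stub_coherenceModKappa` and S3
`stub_linStokesSymLocalisedReduced` (both crux-sized: they need the Kontsevich/Nori formal period
algebra and a sound rules→Nori symbol as DEFINITION items — nothing in the tree inhabits
`KZ.NoriSymbolData`), S4 (= item 0540, open problem).

## Registered stubs (v1 list; see Status above)

* S1  `stub_cubeNashNormalForm` — item stmt-KontsevichZagierPeriods-3574 (route LiftingCriteria) BY NAME;
  cube resolution of every class via the landed `SectorToKernel.cubeResolution_of_cubeNashNormalForm`.
* S2a′ `stub_subdivGeneration` — `KZ.cubicalSubdivGens ⊆ linStokesSymIdeal` (NEW; provable now, M–L;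
  the refuting witness family, proof written out in its docstring).
* S2a″ `stub_covGeneration` — `KZ.cubicalCovGens ⊆ linStokesSymIdeal` (NEW; provable now, L; homotopy
  pull-back of the volume form + hyperoctahedral normalisation). With S2a′ it gives `greenGeneration :
  KZ.cubicalSpan ≤ linStokesSymIdeal` (proved below from the two): Lin + StokesLast + Sym generate the
  four-family cubical calculus — the bridge that makes the target literally Ayoub's presentation (for
  which alone S3 has a source) and the exact answer to the S2 death (`KZ.cubicalSpan = linStokesSymIdeal`
  as Sym ⊆ Cov).
* S2b `stub_coherenceModKappa` — COHERENCE modulo `κ`-powers: a `ℤ`-combination of tame cube classes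
  that is a KZ relation (chains through arbitrary semialgebraic representations allowed) lies, after
  finitely many prefixed factors `[κ]`, in the cubical move span `KZ.cubicalSpan`. Theorem-TYPE, XL
  (sound rules → Nori symbol + Ayoub's presentation theorem + real descent); = the old
  `stub_cubicalCoherence` of line effective-end-monoid WEAKENED by the localisation (that stub was
  blocked, never refuted). HARDEST.
* S3  `stub_linStokesSymLocalisedReduced` — the Lin+Stokes+Sym presentation localised at `κ` has no
  square-zero elements, in the form the composition consumes. Named-fact TYPE: Ayoub 2014 Prop. 11
  (status: CLAIMED — Choudhury–Gallauer 2017, arXiv:1410.6104 p. 3: "as was claimed in loc. cit.";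
  they announce, not give, a proof) + Nori's torsor theorem + Cartier (HMS 2017 §13.1–13.2, Rem. 13.2.4)
  + real descent + the tame-versus-polydisc reduction (dyadic subdivision ∈ `KZ.cubicalSpan`).
* S4  `stub_piCancellation` — `KZ.PiCancellation`, = item stmt-KontsevichZagierPeriods-0540. Open,
  period-conjecture type; all transcendence-type weight of the crux sits here
  (`ReducedPeriodRingNilShadow.reducedPeriodRing_iff_sqZero_shadow`: only its square-zero restriction is
  needed, and that restriction is as unsourced as 0540).

Proved here (no `sorry` outside the stubs): `cubicalSymGens_subset_relations`,
`linStokesSymIdeal_le_relations` (soundness), `greenGeneration` (from S2a′, S2a″), `exists_isKappa`,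
`kappa_mem_cubicalGens`, the transfer `nilIsPiTorsion_of` (S1, S2a′, S2a″, S2b, S3 ⇒ square-zero
classes are `[π]`-power torsion) and the composition `ReducedPeriodRing_of` (crux BY NAME,
from `nilIsPiTorsion_of` and S4).

Disproof used (`Cruxes/ReducedPeriodRing/Disproof.lean` v6): §2 `reducedPeriodRing_false_without_sq` —
the square is used (S2b is applied to `a ⋆ a`, S3 extracts the root); §6 — no multiplicative invariant
DETECTS a nilpotent: the line kills nilpotents only after kernel control (S2a+S2b), never detects them;
§9b drop-one models `transfer_needs_surjective / _kernel_control / _localised_reduced / _regular` =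
S1 / S2a′+S2a″+S2b / S3 / S4, each load-bearing. Landed Negative lemmas checked against: `not_kernelControlModPi`
(imported below; its ideal `closure (Lin ∪ StokesLast)` is NOT this line's — `example` at the end of
the file records the strict inclusion of generating sets), `DominatedCertificates`, `Certificates`
(certificates must be unbounded w.r.t. volume and must not factor through `eval` — S2b/S3 are not
certificate claims), `OrderTrichotomy` (the order lens is not used).
-/

noncomputable section

set_option linter.dupNamespace false

namespace Summit.KontsevichZagierPeriods.KontsevichZagierPeriods.Cruxes.ReducedPeriodRing.LinStokesSym

open Set MeasureTheory
open Literature.NumberTheory.Transcendental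
open Literature.NumberTheory.Transcendental.KZ hiding cubicalSpan
open Summit.KontsevichZagierPeriods.KontsevichZagierPeriods.Theses.FurushoPentagon
open Summit.KontsevichZagierPeriods.FurushoPentagon.ReducedPeriodRing (unitCube cubicalGens cubicalSpan)
open Summit.KontsevichZagierPeriods.FurushoPentagon.SectorToKernel
  (cubeResolution_of_cubeNashNormalForm leaves_cubeNormalForm resolvedRing_mul_mem_cubicalSpan)
open Summit.KontsevichZagierPeriods.HurwitzMicroSectors.NormalFormPrinciple.PiBox
  (exists_kappa stub_piCalibration)
open Summit.KontsevichZagierPeriods.FurushoPentagon.ReducedPeriodRing.LinStokesSym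

/-! ## The pinned target (vocabulary landed: `Theorems/FurushoPentagonReducedPeriodRingLinStokesSymDefs.lean`)

`cubicalSymGens`, `linStokesSymIdeal`, `IsKappa`, `cubicalSymGens_subset_relations`,
`linStokesSymIdeal_le_relations`, `closure_lin_stokes_le_linStokesSymIdeal` are imported from the
landed vocabulary file (namespace `Summit.KontsevichZagierPeriods.FurushoPentagon.ReducedPeriodRing.LinStokesSym`,
opened below). -/

/-- The kernel `κ` exists (landed `exists_kappa`). [folklore] -/
theorem exists_isKappa : ∃ κ : IntegralRep 1, IsKappa κ := exists_kappa

/-- `{x | x 0 ∈ [0,1]} = [0,1]¹`. [folklore] -/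
theorem setOf_Icc_eq_unitCube : {x : Fin 1 → ℝ | x 0 ∈ Set.Icc (0:ℝ) 1} = unitCube 1 := by
  ext x
  simp only [mem_setOf_eq, Set.mem_Icc,
    Summit.KontsevichZagierPeriods.FurushoPentagon.ReducedPeriodRing.mem_unitCube, Fin.forall_fin_one]

/-- The integrand of `κ` is real analytic everywhere (denominator `≥ 1/2`). [folklore] -/
theorem analyticOnNhd_kappaIntegrand (S : Set (Fin 1 → ℝ)) :
    AnalyticOnNhd ℝ (fun x : Fin 1 → ℝ => 1 / ((1 - x 0) ^ 2 + x 0 ^ 2)) S := by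
  have h0 : AnalyticOnNhd ℝ (fun x : Fin 1 → ℝ => x 0) Set.univ :=
    (ContinuousLinearMap.proj (R := ℝ) (φ := fun _ : Fin 1 => ℝ) 0).analyticOnNhd _
  have hden : AnalyticOnNhd ℝ (fun x : Fin 1 → ℝ => (1 - x 0) ^ 2 + x 0 ^ 2) Set.univ :=
    ((analyticOnNhd_const.sub h0).pow 2).add (h0.pow 2)
  have hpos : ∀ x : Fin 1 → ℝ, (1 - x 0) ^ 2 + x 0 ^ 2 ≠ 0 := fun x => by
    have : 0 < (1 - x 0) ^ 2 + x 0 ^ 2 := by nlinarith [sq_nonneg (x 0 - 1 / 2)]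
    exact this.ne'
  exact (analyticOnNhd_const.div hden fun x _ => hpos x).mono (Set.subset_univ S)

/-- `[κ]` is a tame cube class. [folklore] -/
theorem kappa_mem_cubicalGens {κ : IntegralRep 1} (hκ : IsKappa κ) : of κ ∈ cubicalGens := by
  refine ⟨1, κ, ?_, ?_, rfl⟩
  · rw [hκ.1, setOf_Icc_eq_unitCube]
  · rw [hκ.2]; exact analyticOnNhd_kappaIntegrand _

/-! ## Registered stubs (open) -/

/-- **S1 (cube-Nash normal form) = item stmt-KontsevichZagierPeriods-3574 of route LiftingCriteria, by
name** (its live line: `stub_jungPrepare`, `stub_jungFinish`). Every difference of KZ-rational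
representations is KZ-equivalent to a `ℤ`-combination of tame cube classes; cube resolution of EVERY
class follows by the landed `SectorToKernel.cubeResolution_of_cubeNashNormalForm`. Theorem-grade
(semialgebraic triangulation + embedded resolution). [cite: HuberMullerStachPeriods2017, §12.1; Ayoub2014, Rem. 12] -/
theorem stub_cubeNashNormalForm :
    Summit.KontsevichZagierPeriods.KontsevichZagierPeriods.Theses.LiftingCriteria.CubeNashNormalForm := by
  sorry

/-! S2a′ `stub_subdivGeneration : KZ.cubicalSubdivGens ⊆ linStokesSymIdeal` is LANDED
(`Theorems/FurushoPentagonReducedPeriodRingSubdivGeneration.lean`, p153513) and used by name below. -/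

/-! S2a″ `stub_covGeneration : KZ.cubicalCovGens ⊆ linStokesSymIdeal` (reflections p154244,
reduction chain p155408–p158130, facet structure p160227/p160615/p160962, assembly p162092) and
`greenGeneration : KZ.cubicalSpan ≤ linStokesSymIdeal` are LANDED
(`Theorems/FurushoPentagonReducedPeriodRingCovGeneration.lean`) and used by name below. -/

/-- **S2b (coherence modulo `κ`-powers; the COMPARISON; hardest).** If a `ℤ`-combination `a` of tame
cube classes is a KZ relation (its move chain may pass through arbitrary `ℚ`-semialgebraic
representations, non-analytic data and other domains), then `[κ]^N ⋆ a` (left-nested Fubini products)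
lies in the cubical move span `KZ.cubicalSpan` for some `N`: among tame cubes, the four cubical move
families see every relation of the full calculus once enough factors `∫₀¹du/((1−u)²+u²) = π/2` are
prefixed. This is `stub_cubicalCoherence` of the dead line effective-end-monoid WEAKENED by the
localisation (that stub was blocked for size, never refuted; on the nose it made the target isomorphic
to `P` and the line a costume — here the slack is exactly S4). Route to a proof (summit-free, XL):
(i) a SOUND additive symbol `Ψ : KZ.FormalRep → 𝒫_formal` into the formal period algebra of effective
pairs killing the four moves (Ψ2 of `KZ.NoriSymbolData`, HMS 2017 Ch. 12 "in substance"; thesis shared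
with routes NoriTransfer / VeryGoodTransfer / HodgeColevel), multiplicative on Fubini products;
(ii) injectivity of Ayoub's presentation into `𝒫_formal` after inverting `2πi` (Ayoub 2014 Prop. 11 —
CLAIMED; CG2017 announce a proof via `G_A ≅ G_N`); (iii) `κ ⋆ κ ≡ −(2πi)²/16` on that side, real
descent, tame-to-polydisc by subdivision. Cheapest falsifier: an additive functional on `ℤ[tame cubes]`
vanishing (mod `ℚ̄`) on all four cubical families, stable under `[κ] ⋆ ·`, and transcendental on one KZ
relation among tame cubes — by S2a it must vanish on Lin+Stokes+Sym, which kills every product-measure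
/ slice / corner functional except `eval` (lead c2's analysis, dead note item 1); none is known, and one
would contradict (i)+(ii). [cite: Ayoub2014, Prop. 11; HuberMullerStachPeriods2017, §12.1–13.1; arXiv:1410.6104] -/
theorem stub_coherenceModKappa :
    ∀ κ : IntegralRep 1, IsKappa κ → ∀ a : FormalRep, a ∈ cubicalSpan → a ∈ relations →
      ∃ N : ℕ, (fun x => of κ * x)^[N] a ∈ KZ.cubicalSpan := by
  sorry

/-- **S3 (the Lin+Stokes+Sym presentation, localised at `κ`, has no square-zero elements), in the
exact form the composition consumes** (no ring structure on the quotient is presupposed): for a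
`ℤ`-combination `a` of tame cube classes, if `[κ]^N ⋆ (a ⋆ a) ∈ linStokesSymIdeal` then
`[κ]^M ⋆ a ∈ linStokesSymIdeal` for some `M`. Source chain: Ayoub 2014 Prop. 11 identifies the
polydisc-convergent Lin+Stokes presentation, `2πi` inverted, with the formal period algebra of
Kontsevich/Nori (status CLAIMED, see S2b), the coordinate ring of the TORSOR of tensor isomorphisms
`H_dR ≅ H_B` under Nori's motivic Galois group (HMS 2017 Thm. 13.1.4), a pro-algebraic group over a
field of characteristic `0`, hence smooth (Cartier; HMS Rem. 13.2.4 "X(M) is smooth because G(M) is a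
group scheme over a field of characteristic zero") — so that ring is REDUCED; plus `κ ⋆ κ ≡ −(2πi)²/16`
there, real descent (complex conjugation acts on both sides), and tame → polydisc-convergent pieces by
dyadic subdivision (∈ `KZ.cubicalSpan = linStokesSymIdeal`, S2a). Not a corollary of the crux alone
(it needs S2b to pull `linStokesSymIdeal`-membership back from `relations`); modulo S1+S2a+S2b it is
`IsReduced P[1/π]` = child `NilIsPiTorsion` = stub (R) of item 0541's live line
(`LiouvilleUnfolding…locallyReducedOnTorsion_iff_nilIsPiTorsion`). [cite: Ayoub2014, Prop. 11; HuberMullerStachPeriods2017, §13.1–13.2] -/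
theorem stub_linStokesSymLocalisedReduced :
    ∀ κ : IntegralRep 1, IsKappa κ → ∀ a : FormalRep, a ∈ cubicalSpan → ∀ N : ℕ,
      (fun x => of κ * x)^[N] (a * a) ∈ linStokesSymIdeal →
        ∃ M : ℕ, (fun x => of κ * x)^[M] a ∈ linStokesSymIdeal := by
  sorry

/-- **S4 (`π`-cancellation) = item stmt-KontsevichZagierPeriods-0540** (closed-term form
`[π] ⋆ c ∈ relations → c ∈ relations`; the item's pinned `∀ P` form implies it at `KZ.piRep`). Open,
period-conjecture type (motivic shadow printed open: Huber–Wüstholz 2022 App. A.4); shared with routes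
AyoubSpecialisation / KatzTower / LiouvilleUnfolding / VietaFibre / HurwitzMicroSectors; its live line
has six `spread`/`flux` stubs. ALL transcendence-type weight of the crux sits here.
[cite: HuberWustholz2022, App. A.4; Ayoub2014, Def. 6] -/
theorem stub_piCancellation : PiCancellation := by
  sorry

/-! ## Elementary consequences (proved) -/

/-- Cube resolution of every formal combination, from S1. [cite: Ayoub2014, Rem. 12] -/
theorem resolved_of_S1 (c : FormalRep) : ∃ a ∈ cubicalSpan, c - a ∈ relations :=
  leaves_cubeNormalForm (cubeResolution_of_cubeNashNormalForm stub_cubeNashNormalForm) c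

/-- Left multiplication by `[κ]` preserves `ℤ[tame cubes]`. [folklore] -/
theorem kmul_iterate_mem_cubicalSpan {κ : IntegralRep 1} (hκ : IsKappa κ) (N : ℕ) {a : FormalRep}
    (ha : a ∈ cubicalSpan) : (fun x => of κ * x)^[N] a ∈ cubicalSpan := by
  induction N with
  | zero => simpa using ha
  | succ N ih =>
    rw [Function.iterate_succ_apply']
    exact resolvedRing_mul_mem_cubicalSpan (AddSubgroup.subset_closure (kappa_mem_cubicalGens hκ)) ih

/-- Iterates of a left multiplication commute with doubling. [folklore] -/
theorem iterate_mul_two_nsmul (g : FormalRep) (N : ℕ) (z : FormalRep) :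
    (fun x => g * x)^[N] ((2:ℕ) • z) = (2:ℕ) • (fun x => g * x)^[N] z := by
  induction N generalizing z with
  | zero => rfl
  | succ N ih =>
    rw [Function.iterate_succ_apply, Function.iterate_succ_apply, ← ih]
    congr 1
    simp only [two_nsmul, mul_add]

/-- **`[π]`-iterates versus `[κ]`-iterates**: if `x ≡ y` and `[κ]^N ⋆ y` is a relation then
`[π]^N ⋆ x` is a relation (`[π] ≡ 2[κ]`, relations are a two-sided ideal). [cite: KontsevichZagier2001, §1.1] -/
theorem piIterate_mem_relations_of_kappaIterate {κ : IntegralRep 1} (hκ : IsKappa κ) :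
    ∀ (N : ℕ) (x y : FormalRep), x - y ∈ relations → (fun z => of κ * z)^[N] y ∈ relations →
      (fun z => of piRep * z)^[N] x ∈ relations := by
  have hπκ : of piRep - (2:ℕ) • of κ ∈ relations := stub_piCalibration κ hκ.1 hκ.2
  intro N
  induction N with
  | zero =>
    intro x y hxy hy
    have := relations.add_mem hxy hy
    simpa using this
  | succ N ih =>
    intro x y hxy hy
    rw [Function.iterate_succ_apply]
    rw [Function.iterate_succ_apply] at hy
    refine ih (of piRep * x) ((2:ℕ) • (of κ * y)) ?_ ?_
    · have h1 : of piRep * x - of piRep * y ∈ relations := by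
        rw [← mul_sub]; exact mul_mem_relations_left_holds _ _ hxy
      have h2 : of piRep * y - ((2:ℕ) • of κ) * y ∈ relations := by
        rw [← sub_mul]; exact mul_mem_relations_right_holds _ _ hπκ
      have h3 : ((2:ℕ) • of κ) * y = (2:ℕ) • (of κ * y) := smul_mul_assoc _ _ _
      have := relations.add_mem h1 h2
      rw [h3] at this
      simpa using this
    · rw [iterate_mul_two_nsmul]
      exact relations.nsmul_mem hy 2

/-! ## The transfer (proved): S1 ∧ S2a ∧ S2b ∧ S3 ⇒ square-zero classes are `[π]`-power torsion -/

/-- **The transfer**: resolve `c ≡ a ∈ ℤ[tame cubes]` (S1); `a ⋆ a ≡ c ⋆ c` is a KZ relation among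
tame cubes; coherence (S2b) puts `[κ]^N ⋆ (a ⋆ a)` in the cubical move span, Green generation (S2a′+S2a″) in
`linStokesSymIdeal`; localised reducedness (S3) gives `[κ]^M ⋆ a ∈ linStokesSymIdeal ≤ relations`;
transport back along `c ≡ a`, `[π] ≡ 2[κ]`. [cite: Ayoub2014, Prop. 11] -/
theorem nilIsPiTorsion_of :
    ∀ c : FormalRep, c * c ∈ relations → ∃ N : ℕ, (fun x => of piRep * x)^[N] c ∈ relations := by
  intro c hc
  obtain ⟨κ, hκ⟩ := exists_isKappa
  obtain ⟨a, ha, hca⟩ := resolved_of_S1 c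
  have haa : a * a ∈ relations := by
    have h1 : c * c - a * a ∈ relations := mul_sub_mul_mem_relations hca hca
    have := relations.sub_mem hc h1
    simpa using this
  obtain ⟨N, hN⟩ :=
    stub_coherenceModKappa κ hκ (a * a) (resolvedRing_mul_mem_cubicalSpan ha ha) haa
  have hN' : (fun x => of κ * x)^[N] (a * a) ∈ linStokesSymIdeal := greenGeneration hN
  obtain ⟨M, hM⟩ := stub_linStokesSymLocalisedReduced κ hκ a ha N hN'
  exact ⟨M, piIterate_mem_relations_of_kappaIterate hκ M c a hca (linStokesSymIdeal_le_relations hM)⟩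

/-! ## Composition: the crux by name -/

/-- **The line's deciding step**: S1, S2a′, S2a″, S2b, S3 (through `nilIsPiTorsion_of`) and S4 (= item 0540)
prove the crux `ReducedPeriodRing` BY NAME — peel the `N` factors `[π]` one at a time. [cite: KontsevichZagier2001, §4.1] -/
theorem ReducedPeriodRing_of :
    Summit.KontsevichZagierPeriods.KontsevichZagierPeriods.Theses.FurushoPentagon.ReducedPeriodRing := by
  intro c hc
  obtain ⟨N, hN⟩ := nilIsPiTorsion_of c hc
  induction N with
  | zero => simpa using hN
  | succ N ih =>
    exact ih (stub_piCancellation _ (by simpa only [Function.iterate_succ_apply'] using hN))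

/-! ## The refuted instance is not an instance of this line

The landed `not_kernelControlModPi` concerns `closure (KZ.cubicalLinGens ∪ KZ.cubicalStokesGens)`;
this line's ideal has the extra family `cubicalSymGens`, and its kernel-control target (S2b) is the
four-family span `KZ.cubicalSpan`, which CONTAINS the refuting witness `a₀` (a subdivision generator).
We record the inclusion of generating sets that the refutation does not cover. -/

/-- Subdivision generators — in particular the refuting witness `a₀` — lie in the S2b target
`KZ.cubicalSpan` outright. [folklore] -/
theorem subdivGens_le_target : KZ.cubicalSubdivGens ⊆ (KZ.cubicalSpan : Set FormalRep) :=
  KZ.cubicalSubdivGens_subset_cubicalSpan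

end Summit.KontsevichZagierPeriods.KontsevichZagierPeriods.Cruxes.ReducedPeriodRing.LinStokesSym
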